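import Summits.QuantumFields.GaugeBoot.LimitPoints
import Summits.QuantumFields.GaugeBoot.WilsonLoopRPMinors

/-!
# Gauge-boot: `t ↦ ∫ W̄(t × m) dμ` is a Hankel-positive, antitone, convex sequence at every infinite-volume limit point

Cell `pub-gaugeboot` (HOME `run/shared/lean/pub/pub-gaugeboot/`). CONTENT AND PROOFS BY THE CELL'S FORMULATION LANE
(`pub-gaugeboot-loop`, gen 10: `HOME/pub-gaugeboot-loop/wloops/LimitMonotone.lean`, sha256 `81749205a0941c6d…`, and
`SPECTRAL-POSITIVITY.md` §2 (b), §2.1); adopted into the tree verbatim up to names/docstrings by seat lean3 (gen 3) as the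
task 'P4-bind' of FANOUT-PLAN A116 (4)(b).

For an infinite-volume limit point `μ` of the torus Wilson states ALONG EVEN TORI
(`IsInfiniteVolumeLimitAlong (suRep N) (β/N) Lk μ`, `Lk k + 1` even, `StrictMono Lk`), the function
`f t := ∫ W̄(t × m) dμ` (rectangle with `t` links along axis `0` and `m` along a spatial axis `j ≠ 0`; tree observable
`wilsonLoopObs (normalisedCharacter N ∘ suRep N) (rectWalk 0 0 j t m)`) satisfies: every finite site-Hankel block
`[f (a+b)]_{a,b ∈ S} ⪰ 0` (any real `β`), every link-Hankel block `[f (a+b+1)]_{a,b ∈ S} ⪰ 0` (`β ≥ 0`), `0 ≤ f ≤ 1`,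
the `2 × 2` minors `f (t+1)² ≤ f t · f (t+2)`, hence (elementary core `antitone_of_sq_le_mul_of_bdd`,
`two_mul_le_add_of_sq_le_mul`) `f` is ANTITONE and three-term CONVEX; and a certified upper `WilsonLoopWindow` on
`W̄(t × m)` bounds `f t'` for every `t' ≥ t` (`wilsonLoop_integral_limit_le_of_window`).

Mechanism: NO reflection positivity of `μ` itself is used — for each fixed `t` (finite `S`) the tree's TORUS inequalities
(`gram_wilsonLoop_nonneg_even/odd`, `wilsonExpectation_wilsonLoop_sq_le_even/odd`, `WilsonLoopRPMinors`) hold on every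
even torus of side `≥ 2t + 4`, and closed inequalities pass to the limit (`IsInfiniteVolumeLimitAlong` = convergence on
bounded continuous cylinder observables, as in `WilsonLoopWindow.integral_limit_mem`). On a FIXED torus nothing of the
sort holds (wrap-around): these are statements about LIMIT POINTS ONLY. The Hausdorff-moment representation
(Berg–Christensen–Ressel 1984, Prop. 4.9, 6.11) is NOT formalised; the two Gram families are its full finite content.

HONEST FRAMING (page 1 of every file of this cell): lattice expectations at STATED coupling; not a mass gap, not a
continuum limit, no uniqueness of the limit claimed, never 'string tension'; NOT Yang–Mills-summit-bearing
(barriers `FixedCouplingUltralocality`, `PerturbativeInvisibility`).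
-/

noncomputable section

open MeasureTheory Filter Topology
open Literature.MathematicalPhysics.QuantumFieldTheory
open Literature.MathematicalPhysics.QuantumLattice (LGConfig toTorusObservable IsCylinder
  IsInfiniteVolumeLimitAlong wilsonLoopObs rectWalk isCylinder_wilsonLoopObs continuous_wilsonLoopObs
  exists_abs_wilsonLoopObs_le normalisedCharacter continuous_normalisedCharacter_comp)
open Literature.RepresentationTheory.CompactGroups
open Literature.Probability.LatticeModels (Torus.proj)

namespace Summit.QuantumFields.GaugeBoot

namespace WilsonLoopLimit

/-! ## Elementary core (a bounded log-convex non-negative sequence is antitone and convex) -/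

/-- If `0 ≤ f`, `f ≤ C` and `f (t+1)^2 ≤ f t * f (t+2)` for all `t`, then `f` is antitone. [folklore] -/
theorem antitone_of_sq_le_mul_of_bdd (f : ℕ → ℝ) (h0 : ∀ t, 0 ≤ f t) {C : ℝ} (hC : ∀ t, f t ≤ C)
    (hc : ∀ t, f (t + 1) ^ 2 ≤ f t * f (t + 2)) : Antitone f := by
  -- it suffices to show `f (n+1) ≤ f n` for every `n`
  refine antitone_nat_of_succ_le fun n => ?_
  by_contra hlt'
  have hlt : f n < f (n + 1) := lt_of_not_ge hlt'
  -- `f n > 0`: otherwise the minor at `n` forces `f (n+1) = 0`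
  have hn : 0 < f n := by
    rcases (h0 n).eq_or_lt with h | h
    · exfalso
      have h2 : f (n + 1) ^ 2 ≤ 0 := by simpa [← h] using hc n
      have : f (n + 1) = 0 := by nlinarith [h0 (n + 1), sq_nonneg (f (n + 1))]
      linarith [h0 n]
    · exact h
  set r : ℝ := f (n + 1) / f n with hr
  have hr1 : 1 < r := by rw [hr, lt_div_iff₀ hn]; linarith
  have hr0 : 0 < r := by linarith
  -- ratio propagation: `0 < f (n+k)` and `r * f (n+k) ≤ f (n+k+1)` for all `k`
  have key : ∀ k, 0 < f (n + k) ∧ r * f (n + k) ≤ f (n + k + 1) := by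
    intro k
    induction k with
    | zero =>
      refine ⟨by simpa using hn, ?_⟩
      simp only [add_zero]
      rw [hr, div_mul_cancel₀ _ hn.ne']
    | succ k ih =>
      obtain ⟨hpos, hstep⟩ := ih
      have hpos1 : 0 < f (n + k + 1) := lt_of_lt_of_le (mul_pos hr0 hpos) hstep
      refine ⟨by simpa [add_assoc] using hpos1, ?_⟩
      -- from the minor at `n+k`: f(n+k+1)^2 ≤ f(n+k) f(n+k+2), and r f(n+k) ≤ f(n+k+1)
      have hmin := hc (n + k)
      have : r * f (n + k + 1) * f (n + k + 1) ≤ f (n + k + 2) * f (n + k + 1) := by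
        have h3 : r * f (n + k) * f (n + k + 2) ≤ f (n + k + 1) * f (n + k + 2) := by
          have := h0 (n + k + 2)
          nlinarith
        nlinarith
      have h4 : r * f (n + k + 1) ≤ f (n + k + 2) := le_of_mul_le_mul_right this hpos1
      simpa [add_assoc, show (1 : ℕ) + 1 = 2 by norm_num] using h4
  -- hence `r^k * f n ≤ f (n+k) ≤ C`, contradicting `r > 1`
  have grow : ∀ k, r ^ k * f n ≤ f (n + k) := by
    intro k
    induction k with
    | zero => simp
    | succ k ih =>
      have := (key k).2
      calc r ^ (k + 1) * f n = r * (r ^ k * f n) := by ring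
        _ ≤ r * f (n + k) := by exact mul_le_mul_of_nonneg_left ih hr0.le
        _ ≤ f (n + k + 1) := this
        _ = f (n + (k + 1)) := by rw [add_assoc]
  obtain ⟨k, hk⟩ : ∃ k : ℕ, C / f n < r ^ k := pow_unbounded_of_one_lt _ hr1
  have : C < r ^ k * f n := by rwa [div_lt_iff₀ hn] at hk
  linarith [grow k, hC (n + k)]

/-- Three-term convexity from the minors alone: `2 f (t+1) ≤ f t + f (t+2)` (AM–GM). [folklore] -/
theorem two_mul_le_add_of_sq_le_mul (f : ℕ → ℝ) (h0 : ∀ t, 0 ≤ f t)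
    (hc : ∀ t, f (t + 1) ^ 2 ≤ f t * f (t + 2)) (t : ℕ) : 2 * f (t + 1) ≤ f t + f (t + 2) := by
  nlinarith [hc t, h0 t, h0 (t + 1), h0 (t + 2), sq_nonneg (f t - f (t + 2))]

/-! ## Binding to the tree: limit points along even tori -/

/-- The origin of `ℤ^D` projects to the origin of every torus. [folklore] -/
theorem torusProj_zero (D L : ℕ) : Torus.proj L (0 : Literature.Probability.LatticeModels.Site D) = 0 := by
  funext i; simp [Torus.proj]

variable {D N : ℕ} [NeZero D]

/-- Torus expectations of the `t × m` rectangle at the origin converge to the `μ`-integral of the `ℤ^D`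
rectangle observable along the limit sequence (definition of `IsInfiniteVolumeLimitAlong`; cf.
`WilsonLoopWindow.integral_limit_mem`). [folklore] -/
theorem tendsto_wilsonExpectation_wilsonLoop {β : ℝ} {Lk : ℕ → ℕ} {μ : Measure (LGConfig D (SU N))}
    (hμ : IsInfiniteVolumeLimitAlong (suRep N) (β / N) Lk μ) (j : Fin D) (t m : ℕ) :
    Tendsto (fun k => wilsonExpectation (suRep N) (β / N)
      (wilsonLoop (suRep N) (0 : Site D (Lk k + 1)) 0 j t m)) atTop
      (𝓝 (∫ U, wilsonLoopObs (normalisedCharacter N ∘ suRep N) (rectWalk (0 : Literature.Probability.LatticeModels.Site D) 0 j t m) U ∂μ)) := by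
  have hχ := continuous_normalisedCharacter_comp (N := N) (continuous_suRep N)
  have h := hμ.2 _ _ (isCylinder_wilsonLoopObs (normalisedCharacter N ∘ suRep N)
    (rectWalk (0 : Literature.Probability.LatticeModels.Site D) 0 j t m)) (continuous_wilsonLoopObs hχ _) (exists_abs_wilsonLoopObs_le hχ _)
  simp only [toTorusObservable_wilsonLoopObs_rectWalk, torusProj_zero] at h
  exact h

/-- **Full Hankel positivity at a limit point (site planes).** For every finite set of heights `S` and real
coefficients `c`: `0 ≤ Σ_{a,b ∈ S} c_a c_b ∫ W̄((a+b) × m) dμ` — the limit of the tree's torus Gram inequality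
`gram_wilsonLoop_nonneg_even`, which holds on every even torus of side `> 2 · max S`. Any real coupling.
[folklore] -/
theorem wilsonLoop_integral_limit_gram_even {β : ℝ} {Lk : ℕ → ℕ} (hmono : StrictMono Lk)
    (heven : ∀ k, Even (Lk k + 1)) {μ : Measure (LGConfig D (SU N))}
    (hμ : IsInfiniteVolumeLimitAlong (suRep N) (β / N) Lk μ) {j : Fin D} (hj : j ≠ 0) (m : ℕ)
    (S : Finset ℕ) (c : ℕ → ℝ) :
    0 ≤ ∑ a ∈ S, ∑ b ∈ S, c a * c b *
      ∫ U, wilsonLoopObs (normalisedCharacter N ∘ suRep N) (rectWalk (0 : Literature.Probability.LatticeModels.Site D) 0 j (a + b) m) U ∂μ := by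
  have hsum := tendsto_finsetSum S fun a _ => tendsto_finsetSum S fun b _ =>
    (tendsto_wilsonExpectation_wilsonLoop hμ j (a + b) m).const_mul (c a * c b)
  refine ge_of_tendsto hsum (Filter.eventually_atTop.2 ⟨2 * S.sup id + 2, fun k hk => ?_⟩)
  have hkL : k ≤ Lk k := hmono.id_le k
  exact gram_wilsonLoop_nonneg_even (suRep N) (heven k) (continuous_suRep N) (β / (N : ℝ)) hj m S
    (fun a ha => by have h := Finset.le_sup (f := id) ha; simp only [id_eq] at h; omega) c

/-- **Full Hankel positivity at a limit point (link planes).** `0 ≤ Σ_{a,b ∈ S} c_a c_b ∫ W̄((a+b+1) × m) dμ`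
for coupling `β/N ≥ 0` (limit of `gram_wilsonLoop_nonneg_odd`). Together with the site version this says that
`t ↦ ∫ W̄(t × m) dμ` is a positive-definite AND shifted-positive-definite bounded function on `(ℕ,+)`, i.e. a
Hausdorff moment sequence (Berg–Christensen–Ressel 1984, Prop. 4.9 p. 114 and 6.11 p. 131) — the
representation itself is not formalised here. [folklore] -/
theorem wilsonLoop_integral_limit_gram_odd {β : ℝ} (hβ : 0 ≤ β) {Lk : ℕ → ℕ} (hmono : StrictMono Lk)
    (heven : ∀ k, Even (Lk k + 1)) {μ : Measure (LGConfig D (SU N))}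
    (hμ : IsInfiniteVolumeLimitAlong (suRep N) (β / N) Lk μ) {j : Fin D} (hj : j ≠ 0) (m : ℕ)
    (S : Finset ℕ) (c : ℕ → ℝ) :
    0 ≤ ∑ a ∈ S, ∑ b ∈ S, c a * c b *
      ∫ U, wilsonLoopObs (normalisedCharacter N ∘ suRep N) (rectWalk (0 : Literature.Probability.LatticeModels.Site D) 0 j (a + b + 1) m) U ∂μ := by
  have hβ' : 0 ≤ β / (N : ℝ) := div_nonneg hβ (Nat.cast_nonneg N)
  have hsum := tendsto_finsetSum S fun a _ => tendsto_finsetSum S fun b _ =>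
    (tendsto_wilsonExpectation_wilsonLoop hμ j (a + b + 1) m).const_mul (c a * c b)
  refine ge_of_tendsto hsum (Filter.eventually_atTop.2 ⟨2 * S.sup id + 4, fun k hk => ?_⟩)
  have hkL : k ≤ Lk k := hmono.id_le k
  exact gram_wilsonLoop_nonneg_odd (suRep N) (heven k) (continuous_suRep N) hβ' hj m S
    (fun a ha => by have h := Finset.le_sup (f := id) ha; simp only [id_eq] at h; omega) c

/-- **Hankel data of a limit point.** For a limit point `μ` of the torus Wilson states along even tori at
coupling `β/N ≥ 0`, the sequence `f t = ∫ W̄(t × m) dμ` satisfies `0 ≤ f t ≤ 1` and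
`f (t+1)² ≤ f t · f (t+2)` for every `t` (limits of the tree's torus RP minors). [folklore] -/
theorem wilsonLoop_integral_limit_hankel {β : ℝ} (hβ : 0 ≤ β) {Lk : ℕ → ℕ} (hmono : StrictMono Lk)
    (heven : ∀ k, Even (Lk k + 1)) {μ : Measure (LGConfig D (SU N))}
    (hμ : IsInfiniteVolumeLimitAlong (suRep N) (β / N) Lk μ) {j : Fin D} (hj : j ≠ 0) (m : ℕ) :
    let f : ℕ → ℝ := fun t =>
      ∫ U, wilsonLoopObs (normalisedCharacter N ∘ suRep N) (rectWalk (0 : Literature.Probability.LatticeModels.Site D) 0 j t m) U ∂μ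
    (∀ t, 0 ≤ f t) ∧ (∀ t, f t ≤ 1) ∧ (∀ t, f (t + 1) ^ 2 ≤ f t * f (t + 2)) := by
  intro f
  have hlim : ∀ t, Tendsto (fun k => wilsonExpectation (suRep N) (β / N)
      (wilsonLoop (suRep N) (0 : Site D (Lk k + 1)) 0 j t m)) atTop (𝓝 (f t)) := fun t =>
    tendsto_wilsonExpectation_wilsonLoop hμ j t m
  have hβ' : 0 ≤ β / (N : ℝ) := div_nonneg hβ (Nat.cast_nonneg N)
  have h0 : ∀ t, 0 ≤ f t := by
    intro t
    refine ge_of_tendsto (hlim t) (Filter.eventually_atTop.2 ⟨2 * t + 2, fun k hk => ?_⟩)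
    have hkL : k ≤ Lk k := hmono.id_le k
    rcases Nat.even_or_odd t with ⟨a, rfl⟩ | ⟨a, rfl⟩
    · exact wilsonExpectation_wilsonLoop_nonneg_even' (heven k) (continuous_suRep N) (β / N) hj
        (k := a) (by omega) m
    · have h := wilsonExpectation_wilsonLoop_nonneg_odd' (heven k) (continuous_suRep N) hβ' hj
        (k := a) (by omega) m
      have e : a + a + 1 = 2 * a + 1 := by ring
      rw [e] at h
      exact h
  have h1 : ∀ t, f t ≤ 1 := fun t =>
    le_of_tendsto (hlim t) (Filter.Eventually.of_forall fun k =>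
      (abs_le.mp (abs_wilsonExpectation_wilsonLoop_le_one (suRep N) (continuous_suRep N) (β / (N : ℝ))
        (0 : Site D (Lk k + 1)) 0 j t m)).2)
  have hc : ∀ t, f (t + 1) ^ 2 ≤ f t * f (t + 2) := by
    intro t
    refine le_of_tendsto_of_tendsto ((hlim (t + 1)).pow 2) ((hlim t).mul (hlim (t + 2)))
      (Filter.eventually_atTop.2 ⟨2 * t + 4, fun k hk => ?_⟩)
    have hkL : k ≤ Lk k := hmono.id_le k
    rcases Nat.even_or_odd t with ⟨a, rfl⟩ | ⟨a, rfl⟩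
    · have key := wilsonExpectation_wilsonLoop_sq_le_even (heven k) (continuous_suRep N) (β / N) hj
        (a := a) (b := a + 1) (by omega) (by omega) m
      have e1 : a + (a + 1) = a + a + 1 := by ring
      have e2 : a + 1 + (a + 1) = a + a + 2 := by ring
      rw [e1, e2] at key
      exact key
    · have key := wilsonExpectation_wilsonLoop_sq_le_odd (heven k) (continuous_suRep N) hβ' hj
        (a := a) (b := a + 1) (by omega) (by omega) m
      have e1 : a + (a + 1) + 1 = 2 * a + 1 + 1 := by ring
      have e2 : a + a + 1 = 2 * a + 1 := by ring
      have e3 : a + 1 + (a + 1) + 1 = 2 * a + 1 + 2 := by ring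
      rw [e1, e2, e3] at key
      exact key
  exact ⟨h0, h1, hc⟩

/-- **Complete monotonicity, cheap half: `t ↦ ∫ W̄(t × m) dμ` is antitone and three-term convex** for every
limit point of the torus Wilson states along even tori at coupling `β/N ≥ 0`.  LIMIT POINTS ONLY — false on
a fixed torus. [folklore] -/
theorem antitone_wilsonLoop_integral_limit {β : ℝ} (hβ : 0 ≤ β) {Lk : ℕ → ℕ} (hmono : StrictMono Lk)
    (heven : ∀ k, Even (Lk k + 1)) {μ : Measure (LGConfig D (SU N))}
    (hμ : IsInfiniteVolumeLimitAlong (suRep N) (β / N) Lk μ) {j : Fin D} (hj : j ≠ 0) (m : ℕ) :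
    Antitone (fun t : ℕ =>
        ∫ U, wilsonLoopObs (normalisedCharacter N ∘ suRep N) (rectWalk (0 : Literature.Probability.LatticeModels.Site D) 0 j t m) U ∂μ) ∧
      ∀ t : ℕ,
        2 * ∫ U, wilsonLoopObs (normalisedCharacter N ∘ suRep N) (rectWalk (0 : Literature.Probability.LatticeModels.Site D) 0 j (t + 1) m) U ∂μ ≤
          ∫ U, wilsonLoopObs (normalisedCharacter N ∘ suRep N) (rectWalk (0 : Literature.Probability.LatticeModels.Site D) 0 j t m) U ∂μ +
            ∫ U, wilsonLoopObs (normalisedCharacter N ∘ suRep N) (rectWalk (0 : Literature.Probability.LatticeModels.Site D) 0 j (t + 2) m) U ∂μ := by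
  obtain ⟨h0, h1, hc⟩ := wilsonLoop_integral_limit_hankel hβ hmono heven hμ hj m
  exact ⟨antitone_of_sq_le_mul_of_bdd _ h0 h1 hc, two_mul_le_add_of_sq_le_mul _ h0 hc⟩

/-- In particular (the zero-solve consequence of SPECTRAL-POSITIVITY §3 in Lean form): a certified UPPER
window on `W̄(t × m)` valid on all even tori `≥ L₀` bounds `∫ W̄(t' × m) dμ` for every `t' ≥ t` at every
such limit point (LIMIT POINTS ONLY). [folklore] -/
theorem wilsonLoop_integral_limit_le_of_window {L₀ : ℕ} {β a b : ℝ} (hβ : 0 ≤ β) {t m t' : ℕ}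
    (h : WilsonLoopWindow N D L₀ β t m a b) (htt' : t ≤ t')
    {Lk : ℕ → ℕ} (hmono : StrictMono Lk) (heven : ∀ k, Even (Lk k + 1))
    {μ : Measure (LGConfig D (SU N))} (hμ : IsInfiniteVolumeLimitAlong (suRep N) (β / N) Lk μ)
    {j : Fin D} (hj : j ≠ 0) :
    ∫ U, wilsonLoopObs (normalisedCharacter N ∘ suRep N) (rectWalk (0 : Literature.Probability.LatticeModels.Site D) 0 j t' m) U ∂μ ≤ b := by
  have hanti := (antitone_wilsonLoop_integral_limit hβ hmono heven hμ hj m).1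
  exact (hanti htt').trans (h.integral_limit_mem hmono heven hμ 0 hj.symm).2

end WilsonLoopLimit

end Summit.QuantumFields.GaugeBoot

end
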